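import Summits.BirchSwinnertonDyer.BirchSwinnertonDyer.Theorems.UniversalToricDescentTwinAlgMuZeroAtThreeOfBetaRoad
import Summits.BirchSwinnertonDyer.BirchSwinnertonDyer.Theorems.UniversalToricDescentBetaRoadParamDefs
import HarnessLib

/-!
# Crux r205 `TwinAlgMuZeroAtThree` (stmt-BirchSwinnertonDyer-24737): the composition of line `beta-road` v19 —
# «K1‴ ∧ K2a‴ ∧ C₀′ ⟹ the crux BY NAME» WITH THE CRUX'S MODULAR-PARAMETRISATION BINDER `Dt′` THREADED TO THE STUBS

Cell `pub/bsd-wall`, LEAD lineage `bsd-wall-utd-p1` (g34), 2026-08-30; `--supports stmt-BirchSwinnertonDyer-24737 --as helper`.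
THEOREMS ONLY (no definition, no named fact, no instance, no `sorry`).  Sequel of `UniversalToricDescentTwinAlgMuZeroAtThreeOfBetaRoad`
(p771272, v16 composition «K1″ → K2a‴ → C₀ → crux»).

WHAT CHANGES AND WHY (LEAD g34 audit).  The crux hands every consumer a modular parametrisation `(Dt' : ModularParametrizationData W' N')`
of the twin (Modularity + uniformisation + integral Manin constant AS DATA — the named fact `nonempty_modularParametrizationData`, BCDT Thm. A).
The v16/v18 composition introduces `Dt'` and discards it (`twinAlgMuZeroAtThree_of_betaRoadStubs`, `intro … Dt' …` unused; vet flag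
`ground.unused-binder Dt'`), while two of its three hypotheses need exactly that datum: K1″ concludes `∃ (Dt : ModularParametrizationData W' N') …`
from arithmetic binders alone (so proving K1″ means proving Modularity-as-data for every bucket-B twin first), and C₀ is the R2 bucket MINUS
`Dt'`.  Here the binder is threaded: the hypotheses are the constants of `UniversalToricDescentBetaRoadParamDefs` — K1‴
`PrincipalHeegnerIndivisibleMultOfParamAtThree` and C₀′ `TwinAlgMuZeroAtThreeGoodSSOfParam` (each = the old text + the binder `Dt'` at the
crux's position) — and K2a‴ `UniversalToricDescentKsTwinLambdaDefs.KsTwinLambdaAdicAtThree` unchanged (its `HeegnerFamily` binder already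
carries a parametrisation).  Both new hypotheses are IMPLIED by the old ones (§1), so the v19 stub set is WEAKER than v18's and the v18
closure is recovered as a corollary (§3, `twinAlgMuZeroAtThree_of_betaRoadStubs_v18`).

* §1 `principalHeegnerIndivisibleMultOfParam_of_principalHeegnerIndivisibleMult` (K1″ → K1‴), `twinAlgMuZeroAtThreeGoodSSOfParam_of_twinAlgMuZeroAtThreeGoodSS` (C₀ → C₀′).
* §2 `coherentBetaMult_of_principalIndivisibleOfParam` (K1 at a datum from K1‴ + `Dt'`: the canonical coherent Heegner family through K1‴'s
  witness, `…TwinCoherentHeegnerFamily.twin_coherentBeta_of_principalNotDivisible`, p769367), `twinAlgMuZeroAtThree_mult_of_betaRoadParam`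
  (bucket B: the v16 chain K1(𝔭) · K1(𝔭′) · K2_res (`residualCorankLeOneMult_of_ksTwinLambda`) · P_res (`stub_residualLinkMult`, p745706) · receptacle
  `isTorsion_and_exists_generator_of_finite_pTorsion`, verbatim but fed by K1‴ at `Dt'`).
* §3 `twinAlgMuZeroAtThree_of_betaRoadParamStubs` : K1‴ → K2a‴ → C₀′ → crux BY NAME (= skeleton v19's `TwinAlgMuZeroAtThree_of` with its
  `sorry`s as hypotheses); `twinAlgMuZeroAtThree_of_betaRoadStubs_v18` (the v18 hypotheses still suffice, through §1).

HONEST FRAMING: CONDITIONAL theorems — all three hypotheses are open research statements (obligation nodes); nothing is discharged; crux 24737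
and item 32864 stay OPEN; the Birch–Swinnerton-Dyer conjecture is proved for no curve by this file.
References: [Howard2004HeegnerKolyvagin] Thm. 1.6.1, Thm. 2.3.1, Thm. B; [CastellaGrossiLeeSkinner2022] Thm. 4.1.1, Rem. 4.1.4; [BertoliniDarmon1996] §2.5;
[GreenbergLNM1716] §1; [BCDTJAMS2001] Thm. A (what the binder `Dt'` carries).
-/

noncomputable section

open scoped Classical Pointwise ContRepresentation TensorProduct NumberField

set_option linter.dupNamespace false -- `…BirchSwinnertonDyer.BirchSwinnertonDyer…` is the cell's nested layout (D-0017)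
set_option autoImplicit false

namespace Summit.BirchSwinnertonDyer.BirchSwinnertonDyer.Theorems.UniversalToricDescentTwinAlgMuZeroAtThreeOfBetaRoadParam

open NumberField IsDedekindDomain Field WeierstrassCurve
open Literature.NumberTheory.EllipticCurves Literature.NumberTheory.EllipticCurves.GreenbergSelmer
  Literature.NumberTheory.EllipticCurves.IwasawaAlgebra
open Summit.BirchSwinnertonDyer.Rank1Residual.X11b Summit.BirchSwinnertonDyer.Rank1Residual.X11b.AcSelmer
open Summit.BirchSwinnertonDyer.BirchSwinnertonDyer.Theorems.UniversalToricDescentAcDualMuZero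
open Summit.BirchSwinnertonDyer.BirchSwinnertonDyer.Theorems
open Summit.BirchSwinnertonDyer.BirchSwinnertonDyer.Theorems.UniversalToricDescentTwinAlgMuZeroAtThreeOfBetaRoad
open Literature.NumberTheory.EllipticCurves.ZpExtension Literature.NumberTheory.EllipticCurves.Castella2024
open Summit.BirchSwinnertonDyer.BirchSwinnertonDyer.Theorems.UniversalToricDescentStrictPlace
open Literature.NumberTheory.EllipticCurves.ModularForms (ModularParametrizationData heegnerPointComplexOfConductor)

/-! ## 1. The v19 stubs are implied by the v18 stubs -/

/-- **K1″ → K1‴**: the v18 constant (which produces the parametrisation datum from the arithmetic binders alone) implies the v19 constant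
(which is handed the crux's `Dt'` and ignores it). [cite: Castella2024, §2.2 (shape; nothing asserted)] -/
theorem principalHeegnerIndivisibleMultOfParam_of_principalHeegnerIndivisibleMult
    (hK1 : UniversalToricDescentPrincipalHeegnerIndivisibleDefs.PrincipalHeegnerIndivisibleMultAtThree) :
    UniversalToricDescentBetaRoadParamDefs.PrincipalHeegnerIndivisibleMultOfParamAtThree := by
  intro W' _ _ N' _ K _ _ _Dt' hm htr hsurj hN hK hH hodd κ hκ 𝔭 h𝔭 he hf
  exact (UniversalToricDescentPrincipalHeegnerIndivisibleDefs.principalHeegnerIndivisibleMultAtThree_iff.mp hK1)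
    W' N' K hm htr hsurj hN hK hH hodd κ hκ 𝔭 h𝔭 he hf

/-- **C₀ → C₀′**: the v18 constant (the `a₃ = 0` bucket of R2 without the binder `Dt'`) implies the v19 constant (the bucket binder-for-binder).
[cite: Howard2004HeegnerKolyvagin, Thm. B (shape only)] -/
theorem twinAlgMuZeroAtThreeGoodSSOfParam_of_twinAlgMuZeroAtThreeGoodSS
    (hC0 : UniversalToricDescentTwinGoodSSDefs.TwinAlgMuZeroAtThreeGoodSS) :
    UniversalToricDescentBetaRoadParamDefs.TwinAlgMuZeroAtThreeGoodSSOfParam := by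
  intro W' _ _ N' _ K _ _ _Dt' hss ha hsurj hN hK hH hodd κ hκ γ _ 𝔭 h𝔭 he hf 𝔭' h𝔭' hne
  exact (UniversalToricDescentTwinGoodSSDefs.twinAlgMuZeroAtThreeGoodSS_iff.mp hC0)
    W' N' K hss ha hsurj hN hK hH hodd κ hκ γ 𝔭 h𝔭 he hf 𝔭' h𝔭' hne

/-! ## 2. Bucket B from K1‴ and K2a‴, given the crux's parametrisation `Dt'` -/

/-- **K1 at a datum from K1‴ and the parametrisation `Dt'`**: a norm-coherent Heegner family `F` of the twin (sign `α`, `α² = 1`) with a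
layer `k` whose norm point has NON-ZERO local Kummer class on `Γ_{K_k} ∩ D_𝔭` on every third root — the CANONICAL family through K1‴'s
witness (`…TwinCoherentHeegnerFamily.twin_coherentBeta_of_principalNotDivisible`) and Kummer injectivity; the per-datum form of
`…OfBetaRoad.coherentBetaMult_of_principalIndivisible`. [cite: BertoliniDarmon1996, §2.5 eq. (7)] [cite: Howard2004HeegnerKolyvagin, §3.3] -/
theorem coherentBetaMult_of_principalIndivisibleOfParam
    (hK1 : UniversalToricDescentBetaRoadParamDefs.PrincipalHeegnerIndivisibleMultOfParamAtThree)
    (W' : WeierstrassCurve ℚ) [W'.IsElliptic] [W'.IsGloballyMinimal] (N' : ℕ) [NeZero N']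
    (K : Type) [Field K] [NumberField K] (Dt' : ModularParametrizationData W' N')
    (hm : Rank1Residual.Mult W' 3) (htr : ¬ 3 ∣ padicValInt 3 W'.minimalDiscriminantInt)
    (hsurj : W'.HasSurjectiveModNGaloisRep 3) (hN : W'.conductorNorm ℤ = N') (hK : IsImaginaryQuadratic K)
    (hH : SatisfiesHeegnerHypothesis N' K) (hodd : Odd (NumberField.discr K))
    (κ : ZpExtension K 3) (hκ : κ.IsAnticyclotomic)
    (γ : absoluteGaloisGroup K) [Fact (κ.IsTopGenerator γ)]
    (𝔭 : HeightOneSpectrum (𝓞 K)) (h𝔭 : ((3 : ℕ) : 𝓞 K) ∈ 𝔭.asIdeal)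
    (he : 𝔭.asIdeal.ramificationIdx (𝓞 ℚ) = 1) (hf : 𝔭.asIdeal.inertiaDeg (𝓞 ℚ) = 1) :
    ∃ (jbar : AlgebraicClosure K →+* ℂ) (F : HeegnerFamily N' W' K κ jbar) (α : ℤ),
      α ^ 2 = 1 ∧ F.IsNormCompatible γ α ∧
      (∃ k : ℕ, ∀ (Q : geomPoints (W'.baseChange K))
        (hQ : ∀ σ ∈ κ.layerSubgroup k ⊓ decomp 𝔭, σ • ((3 : ℤ) • Q) = (3 : ℤ) • Q),
        (3 : ℤ) • Q = F.z k →
          (W'.baseChange K).kummerClassOver (κ.layerSubgroup k ⊓ decomp 𝔭) 3 Q hQ ≠ 0) := by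
  obtain ⟨jbar, Dt, β, hβ, k, x, R, hx, hRsub, htrans, hndiv⟩ :=
    (UniversalToricDescentBetaRoadParamDefs.principalHeegnerIndivisibleMultOfParamAtThree_iff.mp hK1)
      W' N' K Dt' hm htr hsurj hN hK hH hodd κ hκ 𝔭 h𝔭 he hf
  obtain ⟨F, α, -, hα, hcoh, hk⟩ :=
    Summit.BirchSwinnertonDyer.BirchSwinnertonDyer.Theorems.UniversalToricDescentTwinCoherentHeegnerFamily.twin_coherentBeta_of_principalNotDivisible
      W' N' K hm hN hK κ hκ γ (decomp 𝔭) jbar Dt β hβ k x R hx hRsub htrans hndiv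
  exact ⟨jbar, F, α, hα, hcoh, hk⟩

/-- **Bucket B of crux 24737 from K1‴ and K2a‴ BY NAME, given the crux's parametrisation `Dt'`** (the composition of line `beta-road`, v19):
for a twin `W′/ℚ` multiplicative and très ramifié at `3` with `ρ̄₃` onto and conductor `N′`, a modular parametrisation datum `Dt′` at level `N′`,
`K` imaginary quadratic Heegner for `N′` with odd `d_K`, `κ` anticyclotomic with topological generator `γ`, `𝔭 ∋ 3` of degree one and
`𝔭′ ∋ 3`, `𝔭′ ≠ 𝔭`: `X_(∅,0)(E′/K_∞)` at `𝔭′` is `Λ`-torsion and its characteristic ideal in `R₀⟦T⟧` has a generator with a coefficient of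
`3`-adic norm `1`.  The v16 chain verbatim — K1(𝔭) · degree one of `𝔭′` · K1(𝔭′) · K2_res (`residualCorankLeOneMult_of_ksTwinLambda`) · P_res
(`stub_residualLinkMult`, p745706) · `isTorsion_and_exists_generator_of_finite_pTorsion` — with K1 now fed by K1‴ at `Dt'`.  CONDITIONAL on the
two research constants. [cite: Howard2004HeegnerKolyvagin, Thm. B, Thm. 2.3.1] [cite: GreenbergLNM1716, §1] -/
theorem twinAlgMuZeroAtThree_mult_of_betaRoadParam
    (hK1 : UniversalToricDescentBetaRoadParamDefs.PrincipalHeegnerIndivisibleMultOfParamAtThree)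
    (hK2 : UniversalToricDescentKsTwinLambdaDefs.KsTwinLambdaAdicAtThree)
    (W' : WeierstrassCurve ℚ) [W'.IsElliptic] [W'.IsGloballyMinimal] (N' : ℕ) [NeZero N']
    (K : Type) [Field K] [NumberField K] (Dt' : ModularParametrizationData W' N')
    (hm : Rank1Residual.Mult W' 3) (htr : ¬ 3 ∣ padicValInt 3 W'.minimalDiscriminantInt)
    (hsurj : W'.HasSurjectiveModNGaloisRep 3) (hN : W'.conductorNorm ℤ = N') (hK : IsImaginaryQuadratic K)
    (hH : SatisfiesHeegnerHypothesis N' K) (hodd : Odd (NumberField.discr K))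
    (κ : ZpExtension K 3) (hκ : κ.IsAnticyclotomic)
    (γ : absoluteGaloisGroup K) [hγ : Fact (κ.IsTopGenerator γ)]
    (𝔭 : HeightOneSpectrum (𝓞 K)) (h𝔭 : ((3 : ℕ) : 𝓞 K) ∈ 𝔭.asIdeal)
    (he : 𝔭.asIdeal.ramificationIdx (𝓞 ℚ) = 1) (hf : 𝔭.asIdeal.inertiaDeg (𝓞 ℚ) = 1)
    (𝔭' : HeightOneSpectrum (𝓞 K)) (h𝔭' : ((3 : ℕ) : 𝓞 K) ∈ 𝔭'.asIdeal) (hne : 𝔭' ≠ 𝔭) :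
    Module.IsTorsion (IwasawaAlgebra 3) (XAc (W'.baseChange K) 3 κ 𝔭' ∅ γ) ∧
      ∃ g' : UnrSeries 3,
        (XAc.charIdeal (W'.baseChange K) 3 κ 𝔭' ∅ γ).map (PowerSeries.map (Halves.toUnr 3)) =
            Ideal.span {g'} ∧
          ∃ i : ℕ, ‖((PowerSeries.coeff i g' : unrIntegers 3) : ℂ_[3])‖ = 1 := by
  -- K1 at `𝔭` (from K1‴ and `Dt'`)
  obtain ⟨jbar, F, α, hα, hcoh, k, hk⟩ :=
    coherentBetaMult_of_principalIndivisibleOfParam hK1 W' N' K Dt' hm htr hsurj hN hK hH hodd κ hκ γ 𝔭 h𝔭 he hf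
  -- `𝔭′` is of degree one: `3 ∣ N′` (multiplicative) and `K` is Heegner for `N′`
  have h3N : (3 : ℕ) ∣ N' := hN ▸ dvd_conductorNorm_of_mult hm
  obtain ⟨he', hf'⟩ := degreeOne_of_dvd_of_heegner (p := 3) hK hH h3N h𝔭'
  -- K1 at `𝔭′` (from K1‴ and `Dt'`)
  obtain ⟨jbar', F', α', hα', hcoh', k', hk'⟩ :=
    coherentBetaMult_of_principalIndivisibleOfParam hK1 W' N' K Dt' hm htr hsurj hN hK hH hodd κ hκ γ 𝔭' h𝔭' he' hf'
  -- K2_res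
  obtain ⟨C, hC⟩ := residualCorankLeOneMult_of_ksTwinLambda hK2 W' N' K hm htr hsurj hN hK hH hodd κ hκ γ 𝔭 h𝔭 he hf
    jbar F α hα hcoh ⟨k, hk⟩
  -- P_res: the residual two-sided link
  have hfin : Set.Finite {s : selmerAc (W'.baseChange K) 3 κ 𝔭' ∅ | 3 • s = 0} :=
    Summit.BirchSwinnertonDyer.BirchSwinnertonDyer.Cruxes.TwinAlgMuZeroAtThree.BetaRoad.stub_residualLinkMult W' N' K hm htr hsurj hN
      hK hH κ hκ γ 𝔭 h𝔭 he hf 𝔭' h𝔭' hne jbar F α k hα hcoh hk jbar' F' α' k' hα' hcoh' hk' C hC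
  -- the landed receptacle
  haveI : (W'.baseChange K).IsElliptic := by rw [WeierstrassCurve.baseChange]; infer_instance
  exact isTorsion_and_exists_generator_of_finite_pTorsion (W'.baseChange K) 3 κ 𝔭' ∅ γ Set.finite_empty hfin

/-! ## 3. The crux BY NAME from the three v19 stubs -/

/-- **Crux 24737 `TwinAlgMuZeroAtThree` BY NAME from the three registered stubs of line `beta-road` v19** — K1‴, K2a‴, C₀′ as the Theorems
constants — with the crux's own binder `Dt'` PASSED to K1‴ (bucket B, `twinAlgMuZeroAtThree_mult_of_betaRoadParam`) and to C₀′ (bucket C₀).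
CONDITIONAL (three open hypotheses); this is skeleton v19's `TwinAlgMuZeroAtThree_of` with its `sorry`s replaced by hypotheses, nothing more;
24737 stays OPEN. [cite: Howard2004HeegnerKolyvagin, Thm. 2.3.1, Thm. B] -/
theorem twinAlgMuZeroAtThree_of_betaRoadParamStubs
    (hK1 : UniversalToricDescentBetaRoadParamDefs.PrincipalHeegnerIndivisibleMultOfParamAtThree)
    (hK2 : UniversalToricDescentKsTwinLambdaDefs.KsTwinLambdaAdicAtThree)
    (hC0 : UniversalToricDescentBetaRoadParamDefs.TwinAlgMuZeroAtThreeGoodSSOfParam) :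
    Summit.BirchSwinnertonDyer.BirchSwinnertonDyer.Theses.UniversalToricDescent.TwinAlgMuZeroAtThree := by
  intro W' _ _ N' _ K _ _ Dt' hbucket hsurj hN hK hH hodd κ hκ γ _ 𝔭 h𝔭 he hf 𝔭' h𝔭' hne
  rcases hbucket with ⟨hm, htr⟩ | ⟨hss, ha⟩
  · exact twinAlgMuZeroAtThree_mult_of_betaRoadParam hK1 hK2 W' N' K Dt' hm htr hsurj hN hK hH hodd κ hκ γ 𝔭 h𝔭 he hf 𝔭' h𝔭' hne
  · exact (UniversalToricDescentBetaRoadParamDefs.twinAlgMuZeroAtThreeGoodSSOfParam_iff.mp hC0)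
      W' N' K Dt' hss ha hsurj hN hK hH hodd κ hκ γ 𝔭 h𝔭 he hf 𝔭' h𝔭' hne

/-- **The v18 stub set still closes the crux, through the v19 composition** (K1″ → K1‴ and C₀ → C₀′, §1): the reshape v18 → v19 only WEAKENS
the stubs. [cite: Howard2004HeegnerKolyvagin, Thm. 2.3.1, Thm. B] -/
theorem twinAlgMuZeroAtThree_of_betaRoadStubs_v18
    (hK1 : UniversalToricDescentPrincipalHeegnerIndivisibleDefs.PrincipalHeegnerIndivisibleMultAtThree)
    (hK2 : UniversalToricDescentKsTwinLambdaDefs.KsTwinLambdaAdicAtThree)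
    (hC0 : UniversalToricDescentTwinGoodSSDefs.TwinAlgMuZeroAtThreeGoodSS) :
    Summit.BirchSwinnertonDyer.BirchSwinnertonDyer.Theses.UniversalToricDescent.TwinAlgMuZeroAtThree :=
  twinAlgMuZeroAtThree_of_betaRoadParamStubs
    (principalHeegnerIndivisibleMultOfParam_of_principalHeegnerIndivisibleMult hK1) hK2
    (twinAlgMuZeroAtThreeGoodSSOfParam_of_twinAlgMuZeroAtThreeGoodSS hC0)

end Summit.BirchSwinnertonDyer.BirchSwinnertonDyer.Theorems.UniversalToricDescentTwinAlgMuZeroAtThreeOfBetaRoadParam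

end
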